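import Mathlib
import Literature.NumberTheory.Transcendental.KZCalculusProofs
import Summits.KontsevichZagierPeriods.KontsevichZagierPeriods.Theorems.HermiteRigidityGenusTwoCycleTransferPushforwardDimOne
import Summits.KontsevichZagierPeriods.KontsevichZagierPeriods.Theorems.HurwitzMicroSectorsHurwitzSectorComplementStubClausenCellsAux

/-!
# `OffTetraSectorKernel`, line `odd-hyperbolic-ladder`: the Weierstrass substitution

Stub `stub_arcWeierstrass` of the crux `OffTetraSectorKernel` (stmt-KontsevichZagierPeriods-10557,
route HyperbolicBloch): the last move of the reduction of hyperbolic areas to an ARCTANGENT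
CARRIER. For `γ ∈ (−1, 1)` the representation `A = [(γ, 1), (1 − x²)^{-1/2}]` (value `arccos γ`)
is ONE instance of Kontsevich–Zagier's rule (2) (`KZ.changeOfVariablesRel`) away from
`L = [(0, u_γ), 2/(1 + u²)]`, `u_γ = √((1 − γ)/(1 + γ)) = tan (arccos γ / 2)`: the Weierstrass
chart `Φ(u) = (1 − u²)/(1 + u²)` of `ℝ¹` (source `L`, image `A`)

* is a quotient of `ℚ`-polynomials with non-vanishing denominator, hence `ℚ`-semialgebraic;
* has derivative the homothety `Φ'(u) • id`, `Φ'(u) = −4u/(1 + u²)²`, so `|det| = 4u/(1 + u²)²`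
  on `u > 0`;
* is injective on `u > 0` (`Φ(a) = Φ(b)` forces `a² = b²`) and maps `(0, u_γ)` ONTO `(γ, 1)`
  (inverse `u = √((1 − x)/(1 + x))`, strictly decreasing);
* satisfies the pull-back identity `2/(1 + u²) = (1 − Φ(u)²)^{-1/2} · 4u/(1 + u²)²`, because
  `1 − Φ(u)² = (2u/(1 + u²))²`.

Hence `[L] − [A] ∈ changeOfVariablesRel ⊆ relations`, and `[A] − [L] ∈ relations` by symmetry.
Pattern of `TerasomaMultiplicationBetaCancellationStubEulerRationalise.lean`; the scalar derivative
of `Φ` is `ClausenCells.hasDerivAt_cfun` (HurwitzMicroSectors), lifted to `ℝ¹` by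
`GenusTwoCycleTransfer.hasFDerivAt_fin_one` / `det_smul_id_fin_one` (HermiteRigidity). No
definitions are introduced (the chart and its derivative are written out), so that the file is a
pure proof file.

References: M. Kontsevich, D. Zagier, *Periods* (2001), §1.2 rule (2).
-/

noncomputable section

open Set MeasureTheory
open Literature.NumberTheory.Transcendental
open Literature.ModelTheory.ExponentialFields (IsSemialgebraic)
open MvPolynomial (aeval X)
open Summit.KontsevichZagierPeriods.HermiteRigidity.GenusTwoCycleTransfer
  (det_smul_id_fin_one hasFDerivAt_fin_one)
open Summit.KontsevichZagierPeriods.Theorems.HurwitzMicroSectorsHurwitzSectorComplement.ClausenCells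
  (hasDerivAt_cfun)

namespace Summit.KontsevichZagierPeriods.HyperbolicBloch.OffTetraSectorKernel

/-! ## Algebra of the Weierstrass chart `Φ(u) = (1 − u²)/(1 + u²)` -/

/-- `1 − Φ(u)² = (2u/(1 + u²))²` for the Weierstrass chart `Φ(u) = (1 − u²)/(1 + u²)`. [folklore] -/
theorem arcW_one_sub_sq (u : ℝ) :
    1 - ((1 - u ^ 2) / (1 + u ^ 2)) ^ 2 = (2 * u / (1 + u ^ 2)) ^ 2 := by
  have h : (1 + u ^ 2 : ℝ) ≠ 0 := by positivity
  field_simp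
  ring

/-- `√(1 − Φ(u)²) = 2u/(1 + u²)` for `u ≥ 0`. [folklore] -/
theorem arcW_sqrt_one_sub_sq {u : ℝ} (hu : 0 ≤ u) :
    Real.sqrt (1 - ((1 - u ^ 2) / (1 + u ^ 2)) ^ 2) = 2 * u / (1 + u ^ 2) := by
  rw [arcW_one_sub_sq, Real.sqrt_sq (by positivity)]

/-- **The pull-back identity** of the Weierstrass chart (Jacobian `|−4u/(1 + u²)²|` included):
`2/(1 + u²) = (1 − Φ(u)²)^{-1/2} · |−4u/(1 + u²)²|` for `u > 0`. [folklore] -/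
theorem arcW_kernel_identity {u : ℝ} (hu : 0 < u) :
    2 / (1 + u ^ 2) =
      1 / Real.sqrt (1 - ((1 - u ^ 2) / (1 + u ^ 2)) ^ 2) * |-(4 * u) / (1 + u ^ 2) ^ 2| := by
  rw [arcW_sqrt_one_sub_sq hu.le, neg_div, abs_neg, abs_of_pos (by positivity)]
  have h1 : (1 + u ^ 2 : ℝ) ≠ 0 := by positivity
  have h2 : u ≠ 0 := hu.ne'
  rw [div_mul_div_comm, one_mul, eq_div_iff (by positivity)]
  field_simp
  ring

/-! ## The chart on `ℝ¹` -/

/-- The chart `x ↦ (fun _ => Φ (x 0))` of `ℝ¹` has derivative the homothety `Φ'(x 0) • id`,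
`Φ'(u) = −4u/(1 + u²)²`, at every `x` (`ClausenCells.hasDerivAt_cfun` lifted by
`GenusTwoCycleTransfer.hasFDerivAt_fin_one`). [folklore] -/
theorem arcW_hasFDerivAt_chart (x : Fin 1 → ℝ) :
    HasFDerivAt (fun y : Fin 1 → ℝ => fun _ : Fin 1 => (1 - y 0 ^ 2) / (1 + y 0 ^ 2))
      ((-(4 * x 0) / (1 + x 0 ^ 2) ^ 2) • ContinuousLinearMap.id ℝ (Fin 1 → ℝ)) x :=
  hasFDerivAt_fin_one (fun s : ℝ => (1 - s ^ 2) / (1 + s ^ 2)) _ x (hasDerivAt_cfun (x 0))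

/-- The chart is injective on `u > 0` (`Φ(a) = Φ(b)` forces `a² = b²`). [folklore] -/
theorem arcW_injOn_chart (c : ℝ) :
    InjOn (fun y : Fin 1 → ℝ => fun _ : Fin 1 => (1 - y 0 ^ 2) / (1 + y 0 ^ 2))
      {x : Fin 1 → ℝ | x 0 ∈ Ioo (0:ℝ) c} := by
  intro x hx y hy hxy
  have h0x : 0 < x 0 := hx.1
  have h0y : 0 < y 0 := hy.1
  have e := congrFun hxy 0
  dsimp only at e
  rw [div_eq_div_iff (by positivity) (by positivity)] at e
  have e' : x 0 ^ 2 = y 0 ^ 2 := by linear_combination (-(1:ℝ) / 2) * e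
  funext i
  obtain rfl : i = 0 := Fin.fin_one_eq_zero i
  exact (pow_left_inj₀ h0x.le h0y.le two_ne_zero).1 e'

/-- The chart maps `(0, u_γ)`, `u_γ = √((1 − γ)/(1 + γ))`, ONTO `(γ, 1)` for `γ > −1`:
`γ < Φ(u) ↔ u²(1 + γ) < 1 − γ`, `Φ(u) < 1 ↔ 0 < u²`; inverse `u = √((1 − x)/(1 + x))` (for `γ ≥ 1`
both sides are empty). [folklore] -/
theorem arcW_image_chart {γ : ℝ} (hγ : -1 < γ) :
    (fun y : Fin 1 → ℝ => fun _ : Fin 1 => (1 - y 0 ^ 2) / (1 + y 0 ^ 2)) ''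
        {x : Fin 1 → ℝ | x 0 ∈ Ioo (0:ℝ) (Real.sqrt ((1 - γ) / (1 + γ)))} =
      {x : Fin 1 → ℝ | x 0 ∈ Ioo γ 1} := by
  have h1γ : 0 < 1 + γ := by linarith
  ext w
  constructor
  · rintro ⟨x, hx, rfl⟩
    obtain ⟨h0, hu⟩ : 0 < x 0 ∧ x 0 < Real.sqrt ((1 - γ) / (1 + γ)) := hx
    have hsq : x 0 ^ 2 < (1 - γ) / (1 + γ) := (Real.lt_sqrt h0.le).1 hu
    rw [lt_div_iff₀ h1γ] at hsq
    have hd : (0:ℝ) < 1 + x 0 ^ 2 := by positivity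
    have hx2 : 0 < x 0 ^ 2 := by positivity
    show (1 - x 0 ^ 2) / (1 + x 0 ^ 2) ∈ Ioo γ 1
    refine ⟨?_, ?_⟩
    · rw [lt_div_iff₀ hd]
      nlinarith
    · rw [div_lt_one hd]
      linarith
  · rintro ⟨hw0, hw1⟩
    have h1w : 0 < 1 + w 0 := by linarith
    have hr : 0 < (1 - w 0) / (1 + w 0) := div_pos (by linarith) h1w
    refine ⟨fun _ => Real.sqrt ((1 - w 0) / (1 + w 0)), ?_, ?_⟩
    · show Real.sqrt ((1 - w 0) / (1 + w 0)) ∈ Ioo (0:ℝ) (Real.sqrt ((1 - γ) / (1 + γ)))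
      refine ⟨Real.sqrt_pos.2 hr, Real.sqrt_lt_sqrt hr.le ?_⟩
      rw [div_lt_div_iff₀ h1w h1γ]
      nlinarith
    · funext i
      obtain rfl : i = 0 := Fin.fin_one_eq_zero i
      show (1 - Real.sqrt ((1 - w 0) / (1 + w 0)) ^ 2) /
          (1 + Real.sqrt ((1 - w 0) / (1 + w 0)) ^ 2) = w 0
      have h1w' : (1 + w 0) ≠ 0 := h1w.ne'
      rw [Real.sq_sqrt hr.le, div_eq_iff (by positivity)]
      field_simp
      ring

/-- The chart is a `ℚ`-semialgebraic map on any `ℚ`-semialgebraic set (its single component is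
the quotient of the polynomials `1 − X₀²` and `1 + X₀²`, the denominator vanishing nowhere).
[folklore] -/
theorem arcW_isSemialgebraicMapOn_chart {s : Set (Fin 1 → ℝ)} (hs : IsSemialgebraic ℚ s) :
    IsSemialgebraicMapOn ℚ s
      (fun y : Fin 1 → ℝ => fun _ : Fin 1 => (1 - y 0 ^ 2) / (1 + y 0 ^ 2)) := by
  refine IsSemialgebraicMapOn.of_forall hs fun _ => ?_
  refine (isSemialgebraicFunOn_aeval_div_aeval hs (1 - X 0 ^ 2) (1 + X 0 ^ 2)
    fun x _ => ?_).congr fun x _ => ?_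
  · simp only [map_add, map_one, map_pow, MvPolynomial.aeval_X]
    positivity
  · simp only [map_add, map_sub, map_one, map_pow, MvPolynomial.aeval_X]

/-! ## The stub -/

/-- **STUB `stub_arcWeierstrass`** (line `odd-hyperbolic-ladder` of crux
stmt-KontsevichZagierPeriods-10557): THE WEIERSTRASS SUBSTITUTION. For `γ ∈ (−1, 1)`,
`[(γ, 1), (1 − x²)^{-1/2}] ≡ [(0, u_γ), 2/(1 + u²)]` with `u_γ = √((1−γ)/(1+γ)) = tan (arccos γ / 2)`:
one rule-(2) move `x = (1 − u²)/(1 + u²)` (source the `u`-representation `L`, image `A`,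
`|dx/du| = 4u/(1+u²)²`, `(1 − x²)^{-1/2} = (1+u²)/(2u)` on `u > 0`), then symmetry. (The hypothesis
that `γ` is algebraic is not used: both representations are given.)
[cite: KontsevichZagier2001, §1.2 rule (2)] -/
theorem stub_arcWeierstrass :
    ∀ γ : ℝ, IsAlgebraic ℚ γ → -1 < γ → γ < 1 →
    ∀ (A : KZ.IntegralRep 1), A.domain = {x | x 0 ∈ Ioo γ 1} →
      (A.integrand = fun x => 1 / Real.sqrt (1 - x 0 ^ 2)) →
    ∀ (L : KZ.IntegralRep 1), L.domain = {x | x 0 ∈ Ioo 0 (Real.sqrt ((1 - γ) / (1 + γ)))} →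
      (L.integrand = fun x => 2 / (1 + x 0 ^ 2)) →
      KZ.of A - KZ.of L ∈ KZ.relations := by
  intro γ _ hγ _ A hAd hAi L hLd hLi
  have hpos : ∀ x ∈ L.domain, 0 < x 0 := fun x hx => by
    rw [hLd] at hx
    exact hx.1
  -- the chart maps `L.domain = (0, u_γ)` onto `A.domain = (γ, 1)`
  have himage : A.domain =
      (fun y : Fin 1 → ℝ => fun _ : Fin 1 => (1 - y 0 ^ 2) / (1 + y 0 ^ 2)) '' L.domain := by
    rw [hLd, arcW_image_chart hγ, hAd]
  have hinj : InjOn (fun y : Fin 1 → ℝ => fun _ : Fin 1 => (1 - y 0 ^ 2) / (1 + y 0 ^ 2))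
      L.domain := by
    rw [hLd]
    exact arcW_injOn_chart _
  -- one change-of-variables move, source `L`, image `A`
  have h : KZ.Equivalent L A :=
    KZ.changeOfVariablesRel_subset_relations
      ⟨1, L, A, fun y : Fin 1 → ℝ => fun _ : Fin 1 => (1 - y 0 ^ 2) / (1 + y 0 ^ 2),
        fun y : Fin 1 → ℝ => (-(4 * y 0) / (1 + y 0 ^ 2) ^ 2) •
          ContinuousLinearMap.id ℝ (Fin 1 → ℝ),
        arcW_isSemialgebraicMapOn_chart L.isSemialgebraic_domain,
        fun x _ => (arcW_hasFDerivAt_chart x).hasFDerivWithinAt, hinj, himage,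
        fun x hx => by
          -- the pull-back identity on `(0, u_γ)`, Jacobian `|det DΦ| = 4u/(1+u²)²` included
          simp only [hLi, hAi, det_smul_id_fin_one]
          exact arcW_kernel_identity (hpos x hx),
        rfl⟩
  exact h.symm

end Summit.KontsevichZagierPeriods.HyperbolicBloch.OffTetraSectorKernel

end
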